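import Summits.QuantumFields.BalabanUV.Beta.EriceRemainderEnclosureHistoryAutonomyComparisonDualRow

/-!
# EriceRemainderEnclosureHistoryAutonomyComparisonDualConcaveRow — (E136a) **THE DUAL ROW INEQUALITY FOR SEPARABLE CONCAVE MEMORY.**  The comparison theorem of
# (E135b) (`le_of_isotone_excess_affine`: every isotone excess over the AFFINE base compares) uses affinity of the base memory `B u = β₀ + Σ_k L_k u_k` in exactly two
# places: the drop identity and «Φ₀√ℓ isotone» ((E132) `affine_speed_ratio_le`).  Both survive for a SEPARABLE memory `B u = β₀ + Σ_{k<K} f_k(u_k)` whose age profiles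
# `f_k` are `≥ 0`, NON-DECREASING, with `f_k(u)∕u` NON-INCREASING and CONCAVE on ]0,γ] (chord slopes non-increasing in both endpoints) — the per-age weight `L_k` becomes
# the CHORD SLOPE `λ_k` of `f_k` over the base advance `[x_{k+1}, x_k]` of the configuration: the base advance costs `λ_k·Δ⁰_k` EXACTLY, the perturbed advance yields at
# least `λ_k·Δ′_k` (chord below-left), the two-pin offset costs at most `λ_k·T1_k` (chord above-right), and `λ_k x_k ≤ f_k(x_k)`, `λ_k x_{k+1} ≤ f_k(x_{k+1})` (ratio).
# §1 **`concave_speed_ratio_le`** (`p′·B(tail_1 S p) ≤ p·B(tail_1 S p′)` from (E132) `scale_ratio_le` + the ratio hypothesis), `concave_step_eq_drop`; §2 the chord lemmas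
# `chord_pert_ge`, `chord_twopin_le`, `chord_slope_facts` and **`concave_deficit_le`**; §3 **`concave_row_ge`** — (E133) `dual_row_ge` with `λ_k` for `L_k`.  The sequels
# (E136b∕c) run (E134)∕(E135)'s gauge induction on it: comparison at any size for every isotone excess over every separable concave memory; the hinge memory of
# (E56a) (where comparison FAILS) is exactly non-concave.

Cell `pub-balaban`, β-function sub-cell, BINDER row D4 «RemainderConst leaves for Bałaban's split» (`HOME/BINDER-OWNERS.md`; owner lineage `b2b-balaban-beta-an4`;
this file by co-owner #2 lineage `b2b-balaban-beta-d4-p2`, generation 104), β-FLOW TEAM duty (1), FREEZE (0) honoured (def-free; imports (E133) `…ComparisonDualRow` and uses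
its `coupling_gap_le` ∕ `deficit_le_gap` ∕ `dual_two_pin_le` ∕ `dual_two_pin_nonpos`, (E132) `base_gap_damped` ∕ `dual_source_antitone` ∕ `scale_ratio_le`, (E48a)
`family_zero` ∕ `family_mem` ∕ `family_tail_eq` ∕ `le_of_pin_le` ∕ `strictAnti_of_memFlow` BY NAME; nothing restated).

HONEST FRAMING (page 1, verbatim and binding).  *"Discharging BetaPertH makes Bałaban's UV stability UNCONDITIONAL — a real constructive-QFT result; it is
NOT the continuum limit and NOT the Clay problem."*  THIS FILE DISCHARGES NOTHING OF THE KIND.  Elementary real analysis about ABSTRACT functionals on a box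
]0,γ]^ℕ — hypotheses of a census, not facts; the form, signs, ages and moments of Bałaban's (1.22) limit functional are NOT PRINTED ([I] p. 298; GAPS
G-t4-U2-1∕-2) and NOT asserted.  Row D4 class UNCHANGED (critical-path width 0; instance 0∕1; D4 DISCHARGE NO DATE).  NOT CLAIMED here: the comparison theorem (the
sequels); anything printed — NOT B12 Thm 2, NOT BetaPertH, NOT continuum, NOT Clay.

WHAT IS PROVED ([folklore]; 0 `def`, 0 sorry).  §1 **`concave_speed_ratio_le`**, `concave_step_eq_drop`.  §2 `chord_pert_ge`, `chord_twopin_le`, `chord_slope_facts`,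
**`concave_deficit_le`**.  §3 **`concave_row_ge`**.
-/

noncomputable section
open Finset Set

namespace Summit.QuantumFields.BalabanUV.Beta.EriceRemainderEnclosureHistoryAutonomyComparisonDualConcaveRow

open Literature.MathematicalPhysics.QuantumFieldTheory.Balaban1983to89
open Literature.MathematicalPhysics.QuantumFieldTheory.Balaban1983to89.T4BetaStationary
open Literature.MathematicalPhysics.QuantumFieldTheory.Balaban1983to89.T4BetaFlowWellPosed
open Summit.QuantumFields.BalabanUV.Beta.EriceRemainderEnclosureHistoryAutonomyOrder
  (family_zero family_mem family_tail_eq family_succ_eq le_of_pin_le strictAnti_of_memFlow)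
open Summit.QuantumFields.BalabanUV.Beta.EriceRemainderEnclosureHistoryAutonomyComparisonDualOrbit
  (base_gap_damped dual_source_antitone scale_ratio_le dual_gap_le_sum_steps cmp_of_dual_steps_nonneg)
open Summit.QuantumFields.BalabanUV.Beta.EriceRemainderEnclosureHistoryAutonomyComparisonDualRow
  (coupling_gap_le deficit_le_gap dual_two_pin_le dual_two_pin_nonpos)

variable {B B' : (ℕ → ℝ) → ℝ} {M γ b β₀ : ℝ} {f : ℕ → ℝ → ℝ} {K : ℕ} {S : ℝ → ℕ → ℝ} {h' : ℕ → ℝ}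

/-! ## §1 The separable memory `β₀ + Σ_k f_k(u_k)`: the speed ratio and the drop identity -/

/-- **«Φ₀√ℓ ISOTONE» FOR SEPARABLE MEMORY WITH `f_k(u)∕u` NON-INCREASING.**  `B u = β₀ + Σ_{k<K} f_k(u_k)` on the box (`β₀ ≥ 0`, `f_k ≥ 0`, `f_k(b)·a ≤ f_k(a)·b`
for `a ≤ b`), isotone with floor, modulus, unique solutions: for pins `0 < p′ ≤ p ≤ γ`, `p′·B(tail_1 S p) ≤ p·B(tail_1 S p′)` — the base's effective β over the pin
coupling is antitone in the pin ((E132) `scale_ratio_le` + the ratio hypothesis; `affine_speed_ratio_le` is the case `f_k(u) = L_k u`). [folklore] -/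
theorem concave_speed_ratio_le (hBf : ∀ u, SeqBox γ u → B u = β₀ + ∑ k ∈ range K, f k (u k)) (hβ₀ : 0 ≤ β₀)
    (hf0 : ∀ k a, 0 < a → a ≤ γ → 0 ≤ f k a) (hfratio : ∀ k a c, 0 < a → a ≤ c → c ≤ γ → f k c * a ≤ f k a * c)
    (hb : 0 < b)
    (hmono : ∀ u v : ℕ → ℝ, SeqBox γ u → SeqBox γ v → (∀ i, u i ≤ v i) → B u ≤ B v)
    (hB : ∀ u u' : ℕ → ℝ, SeqBox γ u → SeqBox γ u' → ∀ D : ℝ, (∀ j, |u j - u' j| ≤ D) → |B u - B u'| ≤ M * D) (hM : 0 ≤ M)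
    (hlo : ∀ u, SeqBox γ u → b ≤ B u)
    (hS : ∀ p, 0 < p → p ≤ γ → SeqBox γ (S p) ∧ MemFlow B p (S p))
    (huniq : ∀ p, 0 < p → p ≤ γ → ∀ u u' : ℕ → ℝ, SeqBox γ u → SeqBox γ u' → MemFlow B p u → MemFlow B p u' → u = u')
    {p p' : ℝ} (hp' : 0 < p') (hp'p : p' ≤ p) (hpγ : p ≤ γ) :
    p' * B (fun i => S p (1 + i)) ≤ p * B (fun i => S p' (1 + i)) := by
  have hp : 0 < p := hp'.trans_le hp'p
  have hp'γ : p' ≤ γ := hp'p.trans hpγ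
  have hb1 : SeqBox γ (fun i => S p (1 + i)) := fun i => (hS p hp hpγ).1 (1 + i)
  have hb2 : SeqBox γ (fun i => S p' (1 + i)) := fun i => (hS p' hp' hp'γ).1 (1 + i)
  rw [hBf _ hb1, hBf _ hb2, mul_add, mul_add, mul_sum, mul_sum]
  have h0 : p' * β₀ ≤ p * β₀ := mul_le_mul_of_nonneg_right hp'p hβ₀
  have hterm : ∀ k ∈ range K, p' * f k (S p (1 + k)) ≤ p * f k (S p' (1 + k)) := by
    intro k _
    have ha := (hb2 (k)).1; have haγ := (hb2 k).2   -- a = S p′ (1+k)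
    have hcγ := (hb1 k).2
    have hle : S p' (1 + k) ≤ S p (1 + k) :=
      le_of_pin_le hb hB hM hlo huniq hp' hp'p hpγ (hS p' hp' hp'γ).1 (hS p hp hpγ).1 (hS p' hp' hp'γ).2 (hS p hp hpγ).2 (1 + k)
    have hr := scale_ratio_le hb hmono hB hM hlo hS huniq hp' hp'p hpγ (1 + k)   -- S p (1+k) * p′ ≤ S p′ (1+k) * p
    have hq := hfratio k (S p' (1 + k)) (S p (1 + k)) ha hle hcγ               -- f(c)·a ≤ f(a)·c
    have hfa := hf0 k (S p' (1 + k)) ha haγ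
    -- p′ f(c) a ≤ p′ f(a) c = f(a) (c p′) ≤ f(a) (a p)  ⟹  p′ f(c) ≤ p f(a)
    have h1 : p' * f k (S p (1 + k)) * S p' (1 + k) ≤ p * f k (S p' (1 + k)) * S p' (1 + k) := by
      nlinarith [mul_le_mul_of_nonneg_left hq hp'.le, mul_le_mul_of_nonneg_left hr hfa]
    exact le_of_mul_le_mul_right h1 ha
  linarith [sum_le_sum hterm]

/-- **THE DUAL STEP IS THE EXCESS MINUS THE SEPARABLE DROP**: `X′_j = (B′ − B)(tail_{j+1}h′) − Σ_k [f_k((S h′_j)_{1+k}) − f_k(h′_{j+1+k})]`. [folklore] -/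
theorem concave_step_eq_drop (hBf : ∀ u, SeqBox γ u → B u = β₀ + ∑ k ∈ range K, f k (u k))
    (hS : ∀ p, 0 < p → p ≤ γ → SeqBox γ (S p) ∧ MemFlow B p (S p)) (hh' : SeqBox γ h') (j : ℕ) :
    B' (fun i => h' (j + 1 + i)) - B (fun i => S (h' j) (1 + i))
      = (B' (fun i => h' (j + 1 + i)) - B (fun i => h' (j + 1 + i))) - ∑ k ∈ range K, (f k (S (h' j) (1 + k)) - f k (h' (j + 1 + k))) := by
  have hb1 : SeqBox γ (fun i => h' (j + 1 + i)) := fun i => hh' (j + 1 + i)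
  have hb2 : SeqBox γ (fun i => S (h' j) (1 + i)) := fun i => (hS (h' j) (hh' j).1 (hh' j).2).1 (1 + i)
  rw [hBf _ hb1, hBf _ hb2, sum_sub_distrib]; ring

/-! ## §2 The chord slope of an age and the three differences it controls -/

/-- **THE PER-AGE WEIGHT IS THE CHORD SLOPE** `λ = (g(x) − g(x₊))∕(x − x₊)` of `g = f_k` over the base advance `[x₊, x]`; concavity on ]0,γ] (chord slopes non-increasing
in both endpoints) bounds the perturbed advance from BELOW: `w₊ < w`, `x₊ < x ≤ γ`, `w ≤ x`, `w₊ ≤ x₊` give `λ·(w − w₊) ≤ g(w) − g(w₊)`. [folklore] -/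
theorem chord_pert_ge {g : ℝ → ℝ} {x xp w wp : ℝ}
    (hconc : ∀ a c d e, 0 < a → a < c → 0 < d → d < e → a ≤ d → c ≤ e → e ≤ γ → (g e - g d) * (c - a) ≤ (g c - g a) * (e - d))
    (hwp : 0 < wp) (hwpw : wp < w) (hxpx : xp < x) (hwx : w ≤ x) (hwpxp : wp ≤ xp) (hxγ : x ≤ γ) :
    (g x - g xp) / (x - xp) * (w - wp) ≤ g w - g wp := by
  have hxp : 0 < xp := hwp.trans_le hwpxp
  have h := hconc wp w xp x hwp hwpw hxp hxpx hwpxp hwx hxγ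
  rw [div_mul_eq_mul_div, div_le_iff₀ (by linarith)]
  linarith

/-- … and the two-pin offset from ABOVE: for `0 < x₊ < x ≤ σ ≤ γ`, `g(σ) − g(x) ≤ λ·(σ − x)`. [folklore] -/
theorem chord_twopin_le {g : ℝ → ℝ} {x xp σ : ℝ}
    (hconc : ∀ a c d e, 0 < a → a < c → 0 < d → d < e → a ≤ d → c ≤ e → e ≤ γ → (g e - g d) * (c - a) ≤ (g c - g a) * (e - d))
    (hxp : 0 < xp) (hxpx : xp < x) (hxσ : x ≤ σ) (hσγ : σ ≤ γ) :
    g σ - g x ≤ (g x - g xp) / (x - xp) * (σ - x) := by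
  rcases hxσ.eq_or_lt with heq | hlt
  · rw [← heq]; simp
  · have h := hconc xp x x σ hxp hxpx (hxp.trans hxpx) hlt hxpx.le hlt.le hσγ
    rw [div_mul_eq_mul_div, le_div_iff₀ (by linarith)]
    linarith

/-- The chord slope of a non-decreasing `g` is non-negative, and with `g(x)·x₊ ≤ g(x₊)·x` (`g(u)∕u` non-increasing) it satisfies `λ·x₊ ≤ g(x₊)` and `λ·x ≤ g(x)`. [folklore] -/
theorem chord_slope_facts {g : ℝ → ℝ} {x xp : ℝ} (hxpx : xp < x) (hmono : g xp ≤ g x) (hratio : g x * xp ≤ g xp * x) :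
    0 ≤ (g x - g xp) / (x - xp) ∧ (g x - g xp) / (x - xp) * xp ≤ g xp ∧ (g x - g xp) / (x - xp) * x ≤ g x := by
  have hd : 0 < x - xp := by linarith
  refine ⟨div_nonneg (by linarith) hd.le, ?_, ?_⟩
  · rw [div_mul_eq_mul_div, div_le_iff₀ hd]; nlinarith
  · rw [div_mul_eq_mul_div, div_le_iff₀ hd]; nlinarith

/-- **THE DEFICIT OF ONE AGE (separable memory with `f_k(u)∕u` non-increasing).**  As (E133) `dual_deficit_le`, with `concave_speed_ratio_le` supplying the perturbed step
`≥ (w∕x)Φ⁰`: `((S h′_j)_k − (S h′_j)_{k+1}) − (h′_{j+k} − h′_{j+k+1}) ≤ x³Φ⁰·w²δ`. [folklore] -/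
theorem concave_deficit_le (hBf : ∀ u, SeqBox γ u → B u = β₀ + ∑ k ∈ range K, f k (u k)) (hβ₀ : 0 ≤ β₀)
    (hf0 : ∀ k a, 0 < a → a ≤ γ → 0 ≤ f k a) (hfratio : ∀ k a c, 0 < a → a ≤ c → c ≤ γ → f k c * a ≤ f k a * c)
    (hb : 0 < b)
    (hmono : ∀ u v : ℕ → ℝ, SeqBox γ u → SeqBox γ v → (∀ i, u i ≤ v i) → B u ≤ B v)
    (hB : ∀ u u' : ℕ → ℝ, SeqBox γ u → SeqBox γ u' → ∀ D : ℝ, (∀ j, |u j - u' j| ≤ D) → |B u - B u'| ≤ M * D) (hM : 0 ≤ M)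
    (hlo : ∀ u, SeqBox γ u → b ≤ B u)
    (hS : ∀ p, 0 < p → p ≤ γ → SeqBox γ (S p) ∧ MemFlow B p (S p))
    (huniq : ∀ p, 0 < p → p ≤ γ → ∀ u u' : ℕ → ℝ, SeqBox γ u → SeqBox γ u' → MemFlow B p u → MemFlow B p u' → u = u')
    (hh' : SeqBox γ h') {y : ℝ} (hf' : MemFlow B' y h') (j k : ℕ) (hcmp : h' (j + k) ≤ S (h' j) k)
    (hX : B (fun i => S (h' (j + k)) (1 + i)) ≤ B' (fun i => h' (j + k + 1 + i))) :
    (S (h' j) k - S (h' j) (k + 1)) - (h' (j + k) - h' (j + k + 1))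
      ≤ S (h' j) k ^ 3 * (1 / S (h' j) (k + 1) ^ 2 - 1 / S (h' j) k ^ 2) * (h' (j + k) ^ 2 * (1 / h' (j + k) ^ 2 - 1 / S (h' j) k ^ 2)) := by
  have hpj := hh' j
  have hSj := hS (h' j) hpj.1 hpj.2
  have hx := family_mem hS hpj.1 hpj.2 k
  have hw0 : 0 < h' (j + k) := (hh' (j + k)).1
  have hxp : 0 < S (h' j) (k + 1) := (hSj.1 (k + 1)).1
  have hwp : 0 < h' (j + k + 1) := (hh' (j + k + 1)).1
  have hx_lev : 1 / S (h' j) (k + 1) ^ 2 = 1 / S (h' j) k ^ 2 + B (fun i => S (h' j) (k + 1 + i)) := hSj.2.2 k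
  have htail : (fun i => S (h' j) (k + 1 + i)) = (fun i => S (S (h' j) k) (1 + i)) := by
    funext i
    have := congrFun (family_tail_eq hS huniq hpj.1 hpj.2 k) (1 + i)
    simpa [Nat.add_assoc] using this
  have hΦ0 : 0 ≤ B (fun i => S (h' j) (k + 1 + i)) := hb.le.trans (hlo _ (fun i => hSj.1 (k + 1 + i)))
  have hw_lev : 1 / h' (j + k) ^ 2 + h' (j + k) / S (h' j) k * B (fun i => S (h' j) (k + 1 + i)) ≤ 1 / h' (j + k + 1) ^ 2 := by
    have hstep : 1 / h' (j + k + 1) ^ 2 = 1 / h' (j + k) ^ 2 + B' (fun i => h' (j + k + 1 + i)) := hf'.2 (j + k)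
    have hratio := concave_speed_ratio_le hBf hβ₀ hf0 hfratio hb hmono hB hM hlo hS huniq hw0 hcmp hx.2
    rw [htail, hstep]
    have hxpos : 0 < S (h' j) k := hx.1
    have h1 : h' (j + k) / S (h' j) k * B (fun i => S (S (h' j) k) (1 + i)) ≤ B (fun i => S (h' (j + k)) (1 + i)) := by
      rw [div_mul_eq_mul_div, div_le_iff₀ hxpos]
      linarith [hratio]
    linarith [h1, hX]
  have h := deficit_le_gap hw0 hcmp hΦ0 hxp hwp hx_lev hw_lev
  have e : B (fun i => S (h' j) (k + 1 + i)) = 1 / S (h' j) (k + 1) ^ 2 - 1 / S (h' j) k ^ 2 := by rw [hx_lev]; ring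
  rw [e] at h
  exact h

/-! ## §3 The dual row inequality for separable concave memory -/

/-- **THE DUAL ROW INEQUALITY FOR SEPARABLE CONCAVE MEMORY.**  `B u = β₀ + Σ_{k<K} f_k(u_k)` on the box with `β₀ ≥ 0`, each `f_k ≥ 0` non-decreasing, `f_k(u)∕u`
non-increasing and `f_k` CONCAVE on ]0,γ] (chord slopes non-increasing); floor `b > 0`, modulus, unique box solutions `S p`; `B′` with floor and ISOTONE excess, `h′` a
box solution of `B′`.  At a row `n` with comparison from the pin `h′_{n+1}` and non-negative dual steps above: with the chord slopes `λ_k` of `f_k` over the base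
advances `[x_{k+1}, x_k]` of configuration `n+1`, `X′_{n+1} − max(X′_n,0)·Σ_k λ_k (S h′_n)_{1+k}²x_k∕2 − Σ_k λ_k x_k³Φ⁰_k·w_k²δ_k ≤ X′_n` — (E133) `dual_row_ge` with `L_k`
replaced by `λ_k`: base advance = `λ_k·Δ⁰_k` exactly, perturbed advance `≥ λ_k·Δ′_k` and two-pin offset `≤ λ_k·T1_k` by concavity. [folklore] -/
theorem concave_row_ge (hBf : ∀ u, SeqBox γ u → B u = β₀ + ∑ k ∈ range K, f k (u k)) (hβ₀ : 0 ≤ β₀)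
    (hf0 : ∀ k a, 0 < a → a ≤ γ → 0 ≤ f k a) (hfratio : ∀ k a c, 0 < a → a ≤ c → c ≤ γ → f k c * a ≤ f k a * c)
    (hfconc : ∀ k a c d e, 0 < a → a < c → 0 < d → d < e → a ≤ d → c ≤ e → e ≤ γ → (f k e - f k d) * (c - a) ≤ (f k c - f k a) * (e - d))
    (hfmono : ∀ k a c, 0 < a → a ≤ c → c ≤ γ → f k a ≤ f k c)
    (hb : 0 < b)
    (hmono : ∀ u v : ℕ → ℝ, SeqBox γ u → SeqBox γ v → (∀ i, u i ≤ v i) → B u ≤ B v)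
    (hB : ∀ u u' : ℕ → ℝ, SeqBox γ u → SeqBox γ u' → ∀ D : ℝ, (∀ j, |u j - u' j| ≤ D) → |B u - B u'| ≤ M * D) (hM : 0 ≤ M)
    (hlo : ∀ u, SeqBox γ u → b ≤ B u)
    (hS : ∀ p, 0 < p → p ≤ γ → SeqBox γ (S p) ∧ MemFlow B p (S p))
    (huniq : ∀ p, 0 < p → p ≤ γ → ∀ u u' : ℕ → ℝ, SeqBox γ u → SeqBox γ u' → MemFlow B p u → MemFlow B p u' → u = u')
    (hlo' : ∀ u, SeqBox γ u → b ≤ B' u)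
    (hDmono : ∀ u v : ℕ → ℝ, SeqBox γ u → SeqBox γ v → (∀ i, u i ≤ v i) → B' u - B u ≤ B' v - B v)
    (hh' : SeqBox γ h') {y : ℝ} (hf' : MemFlow B' y h') (n : ℕ)
    (hcmp : ∀ l, h' (n + 1 + l) ≤ S (h' (n + 1)) l)
    (hXup : ∀ l, 0 ≤ B' (fun i => h' (n + 1 + l + 1 + i)) - B (fun i => S (h' (n + 1 + l)) (1 + i))) :
    (B' (fun i => h' (n + 1 + 1 + i)) - B (fun i => S (h' (n + 1)) (1 + i)))
      - max (B' (fun i => h' (n + 1 + i)) - B (fun i => S (h' n) (1 + i))) 0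
          * ∑ k ∈ range K, (f k (S (h' (n + 1)) k) - f k (S (h' (n + 1)) (k + 1))) / (S (h' (n + 1)) k - S (h' (n + 1)) (k + 1))
              * (S (h' n) (1 + k) ^ 2 * S (h' (n + 1)) k / 2)
      - ∑ k ∈ range K, (f k (S (h' (n + 1)) k) - f k (S (h' (n + 1)) (k + 1))) / (S (h' (n + 1)) k - S (h' (n + 1)) (k + 1))
          * (S (h' (n + 1)) k ^ 3 * (1 / S (h' (n + 1)) (k + 1) ^ 2 - 1 / S (h' (n + 1)) k ^ 2)
            * (h' (n + 1 + k) ^ 2 * (1 / h' (n + 1 + k) ^ 2 - 1 / S (h' (n + 1)) k ^ 2)))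
      ≤ B' (fun i => h' (n + 1 + i)) - B (fun i => S (h' n) (1 + i)) := by
  have hpos : ∀ j, 0 < h' j := fun j => (hh' j).1
  have hanti : Antitone h' := (strictAnti_of_memFlow hb hlo' hh' hf').antitone
  have hanti' := strictAnti_of_memFlow hb hlo' hh' hf'
  have hpn := hh' n
  have hp1 := hh' (n + 1)
  have hSn := hS (h' n) hpn.1 hpn.2
  have hS1 := hS (h' (n + 1)) hp1.1 hp1.2
  have hxpos : ∀ k, 0 < S (h' (n + 1)) k := fun k => (hS1.1 k).1
  have hxanti := strictAnti_of_memFlow hb hlo hS1.1 hS1.2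
  -- the source only grows going down
  have hsrc := dual_source_antitone (B := B) (B' := B') hDmono hh' hanti n
  rw [show n + 2 = n + 1 + 1 by ring] at hsrc
  -- the two dual steps as excess minus separable drop
  have hd0 := concave_step_eq_drop (B' := B') hBf hS hh' n
  have hd1 := concave_step_eq_drop (B' := B') hBf hS hh' (n + 1)
  -- the level form of X′_n
  have hXlev : B' (fun i => h' (n + 1 + i)) - B (fun i => S (h' n) (1 + i)) = 1 / h' (n + 1) ^ 2 - 1 / S (h' n) 1 ^ 2 := by
    have e1 : 1 / h' (n + 1) ^ 2 = 1 / h' n ^ 2 + B' (fun i => h' (n + 1 + i)) := hf'.2 n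
    have e2 : 1 / S (h' n) (0 + 1) ^ 2 = 1 / S (h' n) 0 ^ 2 + B (fun i => S (h' n) (0 + 1 + i)) := hSn.2.2 0
    rw [family_zero hS hpn.1 hpn.2] at e2
    simp only [Nat.zero_add] at e2
    have e3 : (fun i => S (h' n) (0 + 1 + i)) = (fun i => S (h' n) (1 + i)) := by funext i; simp
    rw [e3] at e2
    linarith
  set X0 : ℝ := B' (fun i => h' (n + 1 + i)) - B (fun i => S (h' n) (1 + i)) with hX0
  -- per age: drop_n(k) − drop_{n+1}(k) ≤ λ_k·[two-pin offset + deficit]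
  have hage : ∀ k ∈ range K,
      (f k (S (h' n) (1 + k)) - f k (h' (n + 1 + k))) - (f k (S (h' (n + 1)) (1 + k)) - f k (h' (n + 1 + 1 + k)))
        ≤ max X0 0 * ((f k (S (h' (n + 1)) k) - f k (S (h' (n + 1)) (k + 1))) / (S (h' (n + 1)) k - S (h' (n + 1)) (k + 1))
              * (S (h' n) (1 + k) ^ 2 * S (h' (n + 1)) k / 2))
          + (f k (S (h' (n + 1)) k) - f k (S (h' (n + 1)) (k + 1))) / (S (h' (n + 1)) k - S (h' (n + 1)) (k + 1))
            * (S (h' (n + 1)) k ^ 3 * (1 / S (h' (n + 1)) (k + 1) ^ 2 - 1 / S (h' (n + 1)) k ^ 2)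
              * (h' (n + 1 + k) ^ 2 * (1 / h' (n + 1 + k) ^ 2 - 1 / S (h' (n + 1)) k ^ 2))) := by
    intro k _
    have hx := hxpos k
    have hxp := hxpos (k + 1)
    have hxpx : S (h' (n + 1)) (k + 1) < S (h' (n + 1)) k := hxanti (Nat.lt_succ_self k)
    have hw : 0 < h' (n + 1 + k) := hpos _
    have hwp : 0 < h' (n + 1 + 1 + k) := hpos _
    have hwpw : h' (n + 1 + 1 + k) < h' (n + 1 + k) := hanti' (show n + 1 + k < n + 1 + 1 + k by omega)
    have hwx : h' (n + 1 + k) ≤ S (h' (n + 1)) k := hcmp k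
    have hwpxp : h' (n + 1 + 1 + k) ≤ S (h' (n + 1)) (k + 1) := by
      have := hcmp (k + 1); rwa [show n + 1 + (k + 1) = n + 1 + 1 + k by ring] at this
    have hxγ : S (h' (n + 1)) k ≤ γ := (hS1.1 k).2
    have hσ := (hSn.1 (1 + k)).1
    have hσγ : S (h' n) (1 + k) ≤ γ := (hSn.1 (1 + k)).2
    set lam : ℝ := (f k (S (h' (n + 1)) k) - f k (S (h' (n + 1)) (k + 1))) / (S (h' (n + 1)) k - S (h' (n + 1)) (k + 1)) with hlam
    obtain ⟨hlam0, _, _⟩ := chord_slope_facts hxpx (hfmono k _ _ hxp hxpx.le hxγ) (hfratio k _ _ hxp hxpx.le hxγ)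
    -- (i) perturbed advance ≥ λ·Δ′
    have h1 : lam * (h' (n + 1 + k) - h' (n + 1 + 1 + k)) ≤ f k (h' (n + 1 + k)) - f k (h' (n + 1 + 1 + k)) :=
      chord_pert_ge (hfconc k) hwp hwpw hxpx hwx hwpxp hxγ
    -- (ii) base advance = λ·Δ⁰
    have h2 : f k (S (h' (n + 1)) k) - f k (S (h' (n + 1)) (k + 1)) = lam * (S (h' (n + 1)) k - S (h' (n + 1)) (k + 1)) := by
      rw [hlam, div_mul_cancel₀]; exact ne_of_gt (by linarith)
    -- (iii) two-pin offset ≤ max(X0,0)·λ·σ²x/2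
    have h3 : f k (S (h' n) (1 + k)) - f k (S (h' (n + 1)) k) ≤ max X0 0 * (lam * (S (h' n) (1 + k) ^ 2 * S (h' (n + 1)) k / 2)) := by
      have hpos3 : 0 ≤ lam * (S (h' n) (1 + k) ^ 2 * S (h' (n + 1)) k / 2) := by positivity
      rcases le_total (h' (n + 1)) (S (h' n) 1) with hle | hle
      · obtain ⟨hge, hT⟩ := dual_two_pin_le hb hmono hB hM hlo hS huniq hh' n hle k
        rw [← hXlev] at hT
        have hc := chord_twopin_le (hfconc k) hxp hxpx (by linarith) hσγ
        have h4 : lam * (S (h' n) (1 + k) - S (h' (n + 1)) k) ≤ lam * (X0 * (S (h' n) (1 + k) ^ 2 * S (h' (n + 1)) k / 2)) :=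
          mul_le_mul_of_nonneg_left hT hlam0
        have h5 : X0 ≤ max X0 0 := le_max_left _ _
        have h6 : 0 ≤ S (h' n) (1 + k) ^ 2 * S (h' (n + 1)) k / 2 := by positivity
        nlinarith [mul_le_mul_of_nonneg_right h5 (mul_nonneg hlam0 h6)]
      · have hT := dual_two_pin_nonpos hb hB hM hlo hS huniq hh' n hle k
        have hfle : f k (S (h' n) (1 + k)) ≤ f k (S (h' (n + 1)) k) := hfmono k _ _ hσ (by linarith) hxγ
        nlinarith [mul_nonneg (le_max_right X0 0) hpos3]
    -- (iv) the deficit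
    have hdef := concave_deficit_le (B' := B') hBf hβ₀ hf0 hfratio hb hmono hB hM hlo hS huniq hh' hf' (n + 1) k hwx (by have := hXup k; linarith)
    have h4 := mul_le_mul_of_nonneg_left hdef hlam0
    rw [show n + 1 + k + 1 = n + 1 + 1 + k by ring, mul_sub] at h4
    rw [show S (h' (n + 1)) (1 + k) = S (h' (n + 1)) (k + 1) by rw [Nat.add_comm 1 k]]
    linarith [h1, h2, h3, h4]
  have hsum := sum_le_sum hage
  rw [sum_sub_distrib, sum_add_distrib, ← mul_sum] at hsum
  linarith [hd0, hd1, hsrc, hsum]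

end Summit.QuantumFields.BalabanUV.Beta.EriceRemainderEnclosureHistoryAutonomyComparisonDualConcaveRow

end
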